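import Summits.BirchSwinnertonDyer.BirchSwinnertonDyer.Theses.PrintCf2
import Summits.BirchSwinnertonDyer.BirchSwinnertonDyer.Theorems.PrintCf2RamifiedOffTYZThetaCriterionLeaf
import HarnessLib

/-!
# Route `PrintCf2`, aside `RamifiedThetaCriterionOfFactsPlus` — CLOSED: the UNIFORM Θ-criterion class of cell `bsd-monsky` (route B, all k)
# (`n ≡ 6 (8)`, `s(n) = 1`, θ-controlled, decidable Θ-certificate odd; isogeny classes) from the ramified bundle PLUS TYZ Thm 1.1 and the §3.1–3.2
# CM-point display, BY NAME (cell `bsd-print-cf2`, p1 g3)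

HONEST FRAMING (cell `bsd-print-cf2`, run/shared/lean/pub/bsd-print-cf2/; route `PrintCf2`, leaf CornerF @ `p = 2` =
`WAllCornerFTwo`, OPEN AS A CLASS): a CLOSING file — it imports the route file and proves ONE aside whose statement carries
its published inputs as an antecedent (facts-relative «OfFactsPlus» typing; nothing asserted, no named fact introduced):
`(𝔅_ram ∧ TianYuanZhang2017.thm11_parity_of_scriptL ∧ TianYuanZhang2017.tyz_cmPointGaloisData) →
Summit.BirchSwinnertonDyer.WAllCornerFTwoRamifiedThetaCriterion` (planner g4, on this seat's TURNKEY 19:21Z). The mathematics is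
cell `bsd-monsky`'s (prover-B, `P2.ThetaDescent.exists_odd_isScriptL_of_thetaCert_of_cmPointGaloisData` + the GZK-only uniform even door), assembled in
`Theorems/PrintCf2RamifiedOffTYZThetaCriterionLeaf.lean` (`PrintCf2.thetaCriterion_of_bundlePlus`, p562098; core `PrintCf2.rankOne_sha_bsdp_two_of_thetaCriterion`) over the leaf file
`Rank1Residual/WAll/TargetCMTwoRamifiedThetaCriterion.lean` (p561271); here only the one-line term. Booking currency:
LITERAL-by-name(`tyz_cmPointGaloisData`). Beyond print: YES (the class theorem of the induction itself, uniform in `k`; Monsky 1990 p. 67 Remark (3) conjectures `k = 2`;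
TYZ Thm 1.2 silent on part of the class). [cite: Monsky1990MockHeegner, p. 67 Remark (3)]
[cite: TianYuanZhang2017, Thm. 1.1, Thm. 3.5, Thm. 3.6] [cite: Miller2011LMS, §1 and Def. 1.1]
-/

noncomputable section

open scoped Classical

open Summit.BirchSwinnertonDyer
open Summit.BirchSwinnertonDyer.BirchSwinnertonDyer.Theses.PrintCf2

set_option autoImplicit false
-- `Summit.BirchSwinnertonDyer.BirchSwinnertonDyer.Theorems` is the layout's namespace (Sub = Summit name).
set_option linter.dupNamespace false

namespace Summit.BirchSwinnertonDyer.BirchSwinnertonDyer.Theorems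

/-- **Aside `RamifiedThetaCriterionOfFactsPlus` holds**: `𝔅_ram ∧ TYZ Thm 1.1 ∧ the CM-point display ⟹` the Θ-criterion leaf,
by `PrintCf2.thetaCriterion_of_bundlePlus`. [cite: TianYuanZhang2017, Thm. 1.1, Thm. 3.5, Thm. 3.6] [cite: Monsky1990MockHeegner, p. 67 Remark (3)] -/
theorem ramifiedThetaCriterionOfFactsPlus_proof : RamifiedThetaCriterionOfFactsPlus :=
  fun h ↦ Summit.BirchSwinnertonDyer.PrintCf2.thetaCriterion_of_bundlePlus h

end Summit.BirchSwinnertonDyer.BirchSwinnertonDyer.Theorems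

end
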